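import Literature.AlgebraicGeometry.Milne1999.SpecialLefschetzGroupInvariantsSpMultiplicity
import Literature.RepresentationTheory.ClassicalInvariants.SymplecticTensorFFTColoured
import HarnessLib

/-!
# Milne 1999, Prop. 3.6 (a) with multiplicity, SEVERAL symplectic blocks: the invariants of
# `⋀•(⊕_σ V_σ ⊗ ℂ^{m_σ})` under `∏_σ Sp(V_σ)` acting blockwise are Lefschetz classes

Family `hodge`, layer `Literature/AlgebraicGeometry/Milne1999`, namespace
`Literature.AlgebraicGeometry.Milne1999` (D-0022). Definitions-free: THEOREMS ONLY (no `def`, no named fact,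
no `sorry`; D-0026, net debt 0). Written for the cell `pub-hodgecm2` (COR-CM), seat `lit-milne`, binder table
`HOME/lit/milne.md` row M4 (the record `Milne1999_specialLefschetzGroup_invariants_le`, Cor. 4.5 / Thm. 3.2 /
Prop. 3.6; its wording is untouched and it is NOT discharged here). Sequel of
`Milne1999/SpecialLefschetzGroupInvariantsSpMultiplicity` (ONE symplectic block `Sp_N` with multiplicity) and
of `Milne1999/SpecialLefschetzGroupInvariantsSp2Multiplicity` (several blocks, but PLANES `Sp₂ = SL₂`): the
abstract criterion for SEVERAL symplectic blocks `∏_σ Sp(V_σ)` of arbitrary rank with arbitrary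
multiplicities, through the coloured tensor FFT for `Sp`
(`RepresentationTheory/ClassicalInvariants/SymplecticTensorFFTColoured`). Consumers: type I with `[F : ℚ] > 1`
and `dim V_σ ≥ 4` and all powers (the "NOT here" of `…RealMultiplicationPowers`), types II/III.

## Source, verbatim

J. S. Milne, *Lefschetz classes on abelian varieties*, Duke Math. J. 96 (1999) 639–675
[`paper:doi-10-1215-s0012-7094-99-09620-5`, held; PDF page = printed page − 638]:

* §2 p. 649: "`S(A)_{/k^{al}} = ∏_σ S_σ`", the factors `S_σ` being symplectic, orthogonal or general linear
  groups according to the type of the simple factor.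
* p. 654 (p0016 L37–41): "The symplectic group. Let `φ` be a nondegenerate skew-symmetric bilinear form on
  `V`, and let `G = Sp(φ)`. […] for even `m`, `(H^{⊗m})^G` is generated as a `k[S_m]`-algebra by
  `φ ⊗ φ ⊗ ⋯ ⊗ φ` (`m/2` copies) (Fulton and Harris 1991, F.13)."
* Prop. 3.6 (p. 655, p0017 L10–15): "With the above notations, `(⋀^*(rH))^G = k[(⊗² rH)^G]` all `r ≥ 1`,
  in each of the following cases: (a) `G = Sp(φ)` […]"; p. 656: "Now `⋀^*(⊕_σ rH_σ) = ⊗_σ ⋀^*(rH_σ)` and so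
  `(⋀^*(⊕ rH_σ))^{∏S_σ} = ⊗_σ (⋀^* rH_σ)^{S_σ}`. Hence it suffices to show that each of the `k`-algebras
  `(⋀^* rH_σ)^{S_σ}` is generated by tensors of degree 2"; Remark 3.7; Cor. 4.5 (p. 659).

## What is proved

* §1 `sum_smul_cupPowOne_spPairWord_mem_family` — the weighted sums over the letters of the contracted pair
  words with ONE WEIGHT MATRIX PER PAIR are products of crossed classes, hence in `Dᵐ ⊗ ℂ`;
  `sum_colouredContraction_smul_eq` — a colour-respecting complete contraction evaluated on position-dependent
  letters is `sgn(π) ·` such a weighted sum (the one-form versions are in `…SpMultiplicity`).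
* §2 **`mem_divisorClassesSpan_of_forall_exteriorPullback_eq_of_spBlocks`** — Prop. 3.6 (a) with
  multiplicity for several blocks, `S(ℂ)`-form on the carriers: `b` a basis of `H¹(B(ℂ); ℂ)` indexed by slots
  `s ∈ J` (colour `col s`) and letters `Fin N`, one nondegenerate alternating `Ω_i` per colour, `G ≤ GL(H¹)`
  containing for every colour `i` and every `g ∈ Sp(Ω_i)` the element acting by `g` on the slots of colour
  `i` and trivially elsewhere, crossed classes `∑ (Ω_{col s}⁻¹)_{ab} b(s,a) ⌣ b(s',b)` of equal-coloured slots
  in `B¹ ⊗ ℂ` ⟹ every `G`-fixed class of `H^{2p}` is in `divisorClassesSpan B.X B.dim p`. Proof: slices of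
  the antisymmetric coefficient function are `∏ Sp`-invariant (`wordRepAt_wordSlice_eq_of_exteriorPullback_eq'`),
  hence combinations of colour-respecting complete contractions
  (`ClassicalInvariants.mem_span_colouredContraction_of_forall_wordRepAt_eq`), evaluated by §1.

NOT here: the application to a concrete endomorphism structure (type I of higher degree, types II/III), which
needs the block-symplectic eigenbasis and the block elements of `S(A)(ℂ)` (sequel); mixed `Sp`/`GL`/`O`
blocks; the record itself.

## References

* [Milne1999LefschetzClasses] J. S. Milne, Lefschetz classes on abelian varieties, Duke Math. J. 96 (1999)
  639–675: §2 p. 649, p. 654 "The symplectic group", Prop. 3.6 (a) (p. 655), Remark 3.7 and p. 656,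
  Cor. 4.5 (p. 659).
* [GoodmanWallachGTM255] R. Goodman, N. R. Wallach, GTM 255 (2009), Thm. 5.3.3 (2), Thm. 5.3.5, §4.1.1.
* [Greub1978Multilinear] W. Greub, Multilinear Algebra (2nd ed., 1978), §5.3–§5.7.
-/

noncomputable section

open scoped BigOperators Matrix
open Literature.AlgebraicTopology.SingularHomology
open Literature.AlgebraicGeometry.HodgeTheory
open Literature.AlgebraicGeometry.Motives
open Literature.Barriers.HodgeConjecture (divisorClassesSpan)
open Literature.RepresentationTheory.GeneralLinear
open Literature.RepresentationTheory.ClassicalInvariants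
open Literature.NumberTheory.DiophantineGeometry

namespace Literature.AlgebraicGeometry.Milne1999

/-! ### §1 Evaluation of a colour-respecting complete contraction on the letters -/

section ContractionEval

variable {K : Type*} [Field K] {M V : Type*} [AddCommGroup M] [Module K M] [AddCommGroup V]
  [Module K V] {ι' : Type*} {n p : ℕ} {B : AbelianVariety ℂ}

/-- The two elements of `Fin 2`. [folklore] -/
private theorem fin2_cases'' (r : Fin 2) : r = 0 ∨ r = 1 := by
  fin_cases r <;> simp

/-- **The weighted sum over the letters of the contracted pair words, one weight matrix PER PAIR, is a product
of crossed classes, hence in `Dᵐ ⊗ ℂ`** (the several-blocks form of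
`sum_smul_cupPowOne_spPairWord_mem`: pair `c` carries the form `Θ_c = φ_{σ(c)}` of its colour; Milne p. 656:
"`(⋀^*(⊕ rH_σ))^{∏ S_σ}` […] each of the `k`-algebras `(⋀^* rH_σ)^{S_σ}` is generated by tensors of degree 2").
[cite: Milne1999LefschetzClasses, Prop. 3.6 (a), Remark 3.7 and p. 656] [cite: GoodmanWallachGTM255, Thm. 5.3.5] -/
theorem sum_smul_cupPowOne_spPairWord_mem_family {ι'' : Type*} (y : ι'' × Fin n → complexBetti B.X 1) :
    ∀ (m : ℕ) (Θ : Fin m → Matrix (Fin n) (Fin n) ℂ) (I J : Fin m → ι''),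
      (∀ c, (∑ a : Fin n, ∑ a' : Fin n, Θ c a a' • cupProduct (rfl : 1 + 1 = 2) (y (I c, a)) (y (J c, a'))) ∈
        Submodule.span ℂ {b : complexBetti B.X 2 | IsRationalClass b ∧ IsOfHodgeType B.dim B.X 2 1 1 b}) →
      (∑ lam : Fin m → Fin n × Fin n, (∏ c, Θ c (lam c).1 (lam c).2) •
          cupPowOne ℂ (Motives.ComplexPoints B.X) (2 * m) (spPairWord y I J lam)) ∈
        divisorClassesSpan B.X B.dim m
  | 0, Θ, I, J, _ => by
    rw [Fintype.sum_unique, Finset.univ_eq_empty, Finset.prod_empty, one_smul]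
    change cupPowOne ℂ (Motives.ComplexPoints B.X) 0 _ ∈ _
    rw [cupPowOne_zero]
    exact Submodule.subset_span (Barriers.HodgeConjecture.mem_divisorMonomials_zero.2 rfl)
  | m + 1, Θ, I, J, hθ => by
    have IH := sum_smul_cupPowOne_spPairWord_mem_family y m (Fin.tail Θ) (Fin.tail I) (Fin.tail J)
      fun c => hθ c.succ
    have h2 : (2 : ℕ) + 2 * m = 2 * (m + 1) := by ring
    have hterm : ∀ (ab : Fin n × Fin n) (lam' : Fin m → Fin n × Fin n),
        cupPowOne ℂ (Motives.ComplexPoints B.X) (2 * (m + 1)) (spPairWord y I J (Fin.cons ab lam')) =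
          cupProduct h2 (cupProduct (rfl : 1 + 1 = 2) (y (I 0, ab.1)) (y (J 0, ab.2)))
            (cupPowOne ℂ (Motives.ComplexPoints B.X) (2 * m)
              (spPairWord y (Fin.tail I) (Fin.tail J) lam')) := by
      intro ab lam'
      have hw : spPairWord y I J (Fin.cons ab lam') = (Fin.cons (y (I 0, ab.1)) (Fin.cons (y (J 0, ab.2))
          (spPairWord y (Fin.tail I) (Fin.tail J) lam')) : Fin (2 * m + 1 + 1) → _) := by
        funext q
        rw [spPairWord_succ_apply, Fin.cons_zero, Fin.tail_cons]
      rw [hw, cupPowOne_cons_cons]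
    have hsum : (∑ x : (Fin n × Fin n) × (Fin m → Fin n × Fin n),
        (∏ c, Θ c (((Fin.consEquiv fun _ : Fin (m + 1) => Fin n × Fin n) x) c).1
          (((Fin.consEquiv fun _ : Fin (m + 1) => Fin n × Fin n) x) c).2) •
        cupPowOne ℂ (Motives.ComplexPoints B.X) (2 * (m + 1))
          (spPairWord y I J ((Fin.consEquiv fun _ : Fin (m + 1) => Fin n × Fin n) x))) =
        cupProduct h2 (∑ a : Fin n, ∑ a' : Fin n, Θ 0 a a' • cupProduct (rfl : 1 + 1 = 2) (y (I 0, a)) (y (J 0, a')))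
          (∑ lam' : Fin m → Fin n × Fin n, (∏ c, Fin.tail Θ c (lam' c).1 (lam' c).2) •
            cupPowOne ℂ (Motives.ComplexPoints B.X) (2 * m)
              (spPairWord y (Fin.tail I) (Fin.tail J) lam')) := by
      rw [Fintype.sum_prod_type, ← Fintype.sum_prod_type' (fun a a' => Θ 0 a a' •
          cupProduct (rfl : 1 + 1 = 2) (y (I 0, a)) (y (J 0, a'))), map_sum (cupProduct h2),
        LinearMap.sum_apply]
      refine Finset.sum_congr rfl fun ab _ => ?_
      rw [LinearMap.map_smul, LinearMap.smul_apply, map_sum (cupProduct h2 _), Finset.smul_sum]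
      refine Finset.sum_congr rfl fun lam' _ => ?_
      have hce : (Fin.consEquiv fun _ : Fin (m + 1) => Fin n × Fin n) (ab, lam') = Fin.cons ab lam' := rfl
      rw [hce, Fin.prod_univ_succ, Fin.cons_zero]
      simp only [Fin.cons_succ]
      rw [hterm ab lam', LinearMap.map_smul, mul_smul]
      rfl
    rw [← (Fin.consEquiv fun _ : Fin (m + 1) => Fin n × Fin n).sum_comp, hsum]
    exact cupProduct_mem_divisorClassesSpan_succ_left h2 (hθ 0) IH

/-- **Evaluating a colour-respecting complete contraction on position-dependent letters** (the several-blocks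
form of `sum_completeContraction_smul_eq`): for an alternating `F` on `2p` arguments, a two-partition `e`
and one weight matrix per position-colour,
`∑_ε λ_e(ε) F(q ↦ y(t q, ε q)) = sgn(π) ∑_λ (∏_c (Θ_{κ(e⁻¹(0,c))})_{λ_c}) F(spPairWord y I J λ)`.
[cite: GoodmanWallachGTM255, Thm. 5.3.5] [cite: Greub1978Multilinear, §5.7] -/
theorem sum_colouredContraction_smul_eq {ι : Type*} (F : M [⋀^Fin (2 * p)]→ₗ[K] V)
    (Θ : ι → Matrix (Fin n) (Fin n) K) (κ : Fin (2 * p) → ι)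
    (e : Fin (2 * p) ≃ Fin 2 × Fin p) (y : ι' × Fin n → M) (t : Fin (2 * p) → ι') :
    ∃ π : Equiv.Perm (Fin (2 * p)), (∀ c r, π (posEquiv p (c, r)) = e.symm (r, c)) ∧
      ∑ ε : Word n (2 * p), colouredContraction Θ κ e ε • F (fun q => y (t q, ε q)) =
        ((Equiv.Perm.sign π : ℤ) : K) •
          ∑ lam : Fin p → Fin n × Fin n, (∏ c, Θ (κ (e.symm (0, c))) (lam c).1 (lam c).2) •
            F (spPairWord y (fun c => t (e.symm (0, c))) (fun c => t (e.symm (1, c))) lam) := by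
  classical
  let π : Equiv.Perm (Fin (2 * p)) := (posEquiv p).symm.trans ((Equiv.prodComm (Fin p) (Fin 2)).trans e.symm)
  have hπ : ∀ c r, π (posEquiv p (c, r)) = e.symm (r, c) := fun c r => by
    simp [π]
  refine ⟨π, hπ, ?_⟩
  have hreindex : ∑ ε : Word n (2 * p), colouredContraction Θ κ e ε • F (fun q => y (t q, ε q)) =
      ∑ ε' : Word n (2 * p), (∏ c, Θ (κ (e.symm (0, c))) (ε' (posEquiv p (c, 0))) (ε' (posEquiv p (c, 1)))) •
        (((Equiv.Perm.sign π : ℤ) : K) • F (fun q => y (t (π q), ε' q))) := by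
    refine Fintype.sum_equiv (Equiv.arrowCongr π.symm (Equiv.refl (Fin n)))
      (fun ε : Word n (2 * p) => colouredContraction Θ κ e ε • F (fun q => y (t q, ε q)))
      (fun ε' : Word n (2 * p) => (∏ c, Θ (κ (e.symm (0, c))) (ε' (posEquiv p (c, 0))) (ε' (posEquiv p (c, 1)))) •
        (((Equiv.Perm.sign π : ℤ) : K) • F (fun q => y (t (π q), ε' q))))
      fun ε => ?_
    have hε' : ∀ q, (Equiv.arrowCongr π.symm (Equiv.refl (Fin n))) ε q = ε (π q) := fun q => by
      simp [Equiv.arrowCongr_apply]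
    simp_rw [hε', hπ]
    rw [colouredContraction_apply]
    congr 1
    have h := map_comp_perm_eq_sign_smul F (fun q => y (t q, ε q)) π
    rw [show ((fun q => y (t q, ε q)) ∘ ⇑π) = fun q => y (t (π q), ε (π q)) from rfl] at h
    rw [h, smul_smul, sign_cast_mul_self, one_smul]
  rw [hreindex, Finset.smul_sum]
  have hword : ∀ ε' : Word n (2 * p), (fun q => y (t (π q), ε' q)) =
      spPairWord y (fun c => t (e.symm (0, c))) (fun c => t (e.symm (1, c))) (pairLettersEquiv n p ε') := by
    intro ε'
    funext q
    obtain ⟨⟨c, r⟩, rfl⟩ := (posEquiv p).surjective q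
    rw [hπ]
    simp only [spPairWord, Equiv.symm_apply_apply, pairLettersEquiv, Equiv.coe_fn_mk]
    rcases fin2_cases'' r with rfl | rfl
    · rw [if_pos rfl]
    · rw [if_neg (by decide)]
  refine Fintype.sum_equiv (pairLettersEquiv n p) _ _ fun ε' => ?_
  conv_lhs => rw [smul_comm, hword ε']
  rfl

end ContractionEval

/-! ### §2 Prop. 3.6 (a) with multiplicity for several `Sp`-blocks: the invariants are Lefschetz classes -/

section Main

variable {B : AbelianVariety ℂ} {J ι : Type*} [Fintype J] [DecidableEq J] [DecidableEq ι] {N : ℕ}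

/-- **Milne 1999, Prop. 3.6 (a) with multiplicity, `S(ℂ)`-form on the carriers, SEVERAL symplectic blocks.**
Let `B` be a complex abelian variety, `b` a basis of `H¹(B(ℂ); ℂ)` indexed by slots `s ∈ J` and letters
`ℓ ∈ Fin N`, every slot carrying a colour `col s ∈ ι` and every colour a nondegenerate alternating matrix
`Ω_i` (the form `φ_σ` on `V_σ = ℂ^N`), and `G ≤ GL(H¹)` a subgroup containing, for every colour `i` and every
`g` with `gᵀ Ω_i g = Ω_i`, the element acting by `g` on the slots of colour `i` and trivially on the others —
the group `∏_σ Sp(V_σ, φ_σ)` acting on `⊕_σ V_σ ⊗ ℂ^{m_σ}` ("`S(A)_{/k^{al}} = ∏_σ S_σ`", Milne p. 649 and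
p. 656, with multiplicity). Suppose the CROSSED CLASSES `θ_{s,s'} = ∑_{a,b} (Ω_{col s}⁻¹)_{ab} b(s,a) ⌣ b(s',b)`
of any two slots of the same colour lie in `B¹(B) ⊗ ℂ`. Then every class `x ∈ H^{2p}(B(ℂ); ℂ)` fixed by
`⋀^{2p}u` for all `u ∈ G` lies in `Dᵖ(B) ⊗ ℂ = divisorClassesSpan B.X B.dim p` ("`(⋀^*(rH))^G = k[(⊗² rH)^G]`
[…] (a) `G = Sp(φ)`", with p. 656: "`(⋀^*(⊕ rH_σ))^{∏S_σ}` […] each of the `k`-algebras `(⋀^* rH_σ)^{S_σ}` is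
generated by tensors of degree 2"). Proof: the slices of the antisymmetric coefficient function are
`∏ Sp`-invariant tensors (`wordRepAt_wordSlice_eq_of_exteriorPullback_eq'`), hence combinations of
colour-respecting complete contractions by the coloured tensor FFT for `Sp`
(`ClassicalInvariants.mem_span_colouredContraction_of_forall_wordRepAt_eq`), each of which evaluates on the
letters to `±` a product of crossed classes (§1).
[cite: Milne1999LefschetzClasses, §2 p. 649, Prop. 3.6 (a) (pp. 654–655), Remark 3.7 and p. 656, Cor. 4.5 (p. 659)]
[cite: GoodmanWallachGTM255, Thm. 5.3.3 (2) and Thm. 5.3.5] -/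
theorem mem_divisorClassesSpan_of_forall_exteriorPullback_eq_of_spBlocks
    (b : Module.Basis (J × Fin N) ℂ (complexBetti B.X 1)) (col : J → ι) (Ω : ι → Matrix (Fin N) (Fin N) ℂ)
    (hΩa : ∀ i, (Matrix.toBilin' (Ω i)).IsAlt) (hΩn : ∀ i, (Matrix.toBilin' (Ω i)).Nondegenerate)
    (G : Subgroup (complexBetti B.X 1 ≃ₗ[ℂ] complexBetti B.X 1))
    (hG : ∀ (i : ι) (g : Matrix (Fin N) (Fin N) ℂ), gᵀ * Ω i * g = Ω i → ∃ u ∈ G, ∀ s ℓ,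
      u (b (s, ℓ)) = ∑ ℓ', (if col s = i then g else 1) ℓ' ℓ • b (s, ℓ'))
    (hcross : ∀ s s' : J, col s = col s' →
      (∑ a : Fin N, ∑ a' : Fin N, (Ω (col s))⁻¹ a a' • cupProduct (rfl : 1 + 1 = 2) (b (s, a)) (b (s', a'))) ∈
        Submodule.span ℂ {c : complexBetti B.X 2 | IsRationalClass c ∧ IsOfHodgeType B.dim B.X 2 1 1 c})
    (p : ℕ) (x : complexBetti B.X (2 * p))
    (hx : ∀ u ∈ G, exteriorPullback (AbelianVariety.hasExteriorCohomologyH1_complexPoints B)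
      (u : complexBetti B.X 1 →ₗ[ℂ] complexBetti B.X 1) (2 * p) x = x) :
    x ∈ divisorClassesSpan B.X B.dim p := by
  classical
  set F := cupPowOneAlt ℂ (ComplexPoints B.X) (2 * p) with hF
  obtain ⟨a, ha, hax⟩ := exists_isAntisymm_wordEval_eq b x
  -- every slice is a `∏ Sp`-invariant tensor
  have hinv : ∀ (t : Fin (2 * p) → J) (i : ι) (g : Matrix (Fin N) (Fin N) ℂ), gᵀ * Ω i * g = Ω i →
      wordRepAt ℂ (fun q => if (col ∘ t) q = i then g else 1) (wordSlice a t) = wordSlice a t := by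
    intro t i g hg
    obtain ⟨u, huG, hu⟩ := hG i g hg
    exact wordRepAt_wordSlice_eq_of_exteriorPullback_eq' b ha (u : complexBetti B.X 1 →ₗ[ℂ] complexBetti B.X 1)
      (fun s => if col s = i then g else 1) (fun s ℓ => hu s ℓ) (by rw [hax]; exact hx u huG) t
  -- slice by slice: the coloured tensor FFT for `Sp` and the evaluation of the complete contractions
  rw [← hax, wordEval_eq_sum_wordSlice]
  refine Submodule.sum_mem _ fun t _ => ?_
  have hmem := mem_span_colouredContraction_of_forall_wordRepAt_eq Ω hΩa hΩn (col ∘ t) (wordSlice a t) (hinv t)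
  set Λ := Fintype.linearCombination ℂ (fun ε : Word N (2 * p) => F (fun q => b (t q, ε q))) with hΛ
  have hΛapply : ∀ c : Word N (2 * p) → ℂ, Λ c = ∑ ε, c ε • F (fun q => b (t q, ε q)) :=
    fun c => Fintype.linearCombination_apply ℂ _ c
  rw [← hΛapply]
  refine (Submodule.span_le (p := (divisorClassesSpan B.X B.dim p).comap Λ)).2 ?_ hmem
  rintro _ ⟨k, e, he, rfl⟩
  rw [SetLike.mem_coe, Submodule.mem_comap, hΛapply]
  -- `k = p`: the two-partition has `p` pairs
  have hk : k = p := by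
    have h := Fintype.card_congr e
    simp only [Fintype.card_fin, Fintype.card_prod] at h
    omega
  subst hk
  obtain ⟨π, -, hsum⟩ := sum_colouredContraction_smul_eq F (fun i => (Ω i)⁻¹) (col ∘ t) e (⇑b) t
  rw [hsum]
  refine Submodule.smul_mem _ _ ?_
  simp_rw [hF, cupPowOneAlt_apply]
  refine sum_smul_cupPowOne_spPairWord_mem_family (⇑b) k _ _ _ fun c => ?_
  exact hcross _ _ (he c)

end Main

end Literature.AlgebraicGeometry.Milne1999
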